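/-
Copyright (c) 2026 the pub-hodgecm-mathlib formalisation cell (harness21).  Prover seat hodgecm-mathlib-LH4-p11 (g8), Track A «(D-RAM) FOUR-FRAME» squad, helper lane on
h413 = stmt-HodgeConjecture-24833 (count-neutral).  Heir dealer∕pen LH4-plan (g13) WORD #70 (2) «(β-BAL) producer»; SCOPE-betaBAL v1 91e23c08 brick B0 (β-BAL-0).  2026-09-04.
-/
import Summits.HodgeConjecture.HodgeConjecture.Theorems.F0P3cDyRamCleanSgnKappaForm   -- ★ p859891 (LH4-p05 (g8)): `sum_kappaChar_mul_const`, `sum_kappaChar_mul_eq` (Fin-4 Fourier bookkeeping); brings ★ #0a `kappaChar`, `signPair`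
import HarnessLib

/-!
# Crux `H413`, line LH4 «(D-RAM) FOUR-FRAME» — (β-BAL-0) «THE EIGHTFOLD ODD-CHARACTER SOCKET»: three vanishing odd sign-character sums of a function on the eight sign
# patterns make `N(s) − N(s̄)` depend on the parity of `s` only, hence kill every κ-sum `Σ_b κ_i(b)·(N(e_b) − N(ē_b))` along a parity-constant frame map `b ↦ e_b`

Cell `hodgecm-mathlib` (D-0151), FLOOR 0, crux item H413 = `stmt-HodgeConjecture-24833`, route `HCCMUnconditional`; squad F0∕P3c∕LH4.  THEOREMS ONLY (no `def`, no instance,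
no notation, no `sorry`, default heartbeats); ★-only imports; lane `--supports stmt-HodgeConjecture-24833 --as helper` (count-neutral); pays NO row, states NO law; pure
`ℤ`-bookkeeping (no field, no lattice).

WHY (SCOPE-betaBAL v1 §1 (R2), §2 (iv) B0).  In the unimodular diagonal model the (β) producer target (β-BAL) «the two label classes have the same κ-census on the clean
shell» reads `Σ_b κ_i(b)·(N(e_b) − N(ē_b)) = 0`, where `s ↦ N(s)` is the class-`+` clean-shell count in the model `diag(u^{s})` indexed by the eight SIGN PATTERNS
`s : Fin 3 → Bool` (`u` a fixed `σ`-fixed non-norm unit), `e_b` is the pattern of frame `b` — `(ε₁ = −1, ε₂ = −1, ω(−1)ε₁ε₂ = −1)`, so its PARITY `e_b 0 ⊻ e_b 1 ⊻ e_b 2` does not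
depend on `b` — and `ē_b` is the complementary pattern (★ (β-BAL-1) `ncard_cleanLabel_diagonal_smul_form`: the class-`u` count of `diag(c)` is the class-`+` count of
`diag(u⁻¹c)`).  The Stage-A∕B engines of the unit produce eightfold pattern sums; the natural labelled statement they can aim at is the vanishing of the three ODD
sign-character sums `Σ_s (−1)^{s_i}·N(s) = 0` (`i = 0, 1, 2`).  This file is the socket between the two currencies:
* §1 `sum_univ_fin_three_bool` — a sum over `Fin 3 → Bool` is the sum of its eight values (bookkeeping); `eq_vec_three_and_compl`.
* §2 `sub_compl_eq_sub_compl_of_odd_sums_eq_zero` — if the three odd sign-character sums of `N` vanish, then `N(s) − N(s̄)` takes the same value on all patterns `s` of the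
  same parity (the four differences `a, b, c, d` attached to the even patterns satisfy `a − d − c + b = a − d − b + c = a − c − b + d = 0`, i.e. `a = b = c = d`); vector and
  function forms.
* §3 HEAD `sum_kappaChar_mul_sub_compl_eq_zero` ∕ `sum_kappaChar_mul_eq_sum_kappaChar_mul_compl` — for every frame map `e : Fin 4 → (Fin 3 → Bool)` of constant parity the
  κ-sums of `b ↦ N(e_b)` and `b ↦ N(ē_b)` agree for each `i : Fin 3` (★ `sum_kappaChar_mul_const`).
HONEST LABEL.  Count-neutral socket; it proves no census: (β-BAL), (A″), (β) and the tier-0 T₊ row stay OPEN; `HC_CM` is proved only modulo the 7 printed citations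
(2 remaining named inputs: hLiu418 = `stmt-HodgeConjecture-24832`, h413 = `stmt-HodgeConjecture-24833`) until rung 0 closes.

## References
* [LanglandsShelstad1987] R. P. Langlands, D. Shelstad, *On the definition of transfer factors*, Math. Ann. 278 (1987), §1.3, §3 (κ ranges over the characters of
  `H¹(F, T) = (ℤ∕2)³`; the endoscopic characters of the four-frame kernel).
* [Rogawski1990] J. D. Rogawski, *Automorphic Representations of Unitary Groups in Three Variables*, Ann. of Math. Stud. 123 (1990), §4.9 Prop. 4.9.1 (a)(b) p. 55, §4.10 p. 58.
* [Kottwitz1986BaseChangeUnits] R. E. Kottwitz, *Base change for unit elements of Hecke algebras*, Compositio Math. 60 (1986), §1 pp. 240–241 (κ-orbital integrals as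
  signed sums over the sign classes of a diagonal torus model).
-/

set_option autoImplicit false

namespace Summit.HodgeConjecture.HodgeConjecture.Cruxes.H413.F0P3cDyRamEightfoldOddCharacterSocket

open Finset
open Literature.NumberTheory.Automorphic.UnitaryThreeFourFrame
open Summit.HodgeConjecture.HodgeConjecture.Cruxes.H413.F0P3cDyRamCleanSgnKappaForm (sum_kappaChar_mul_const)

/-! ## §1  A sum over the eight sign patterns, written out -/

/-- The eight sign patterns: `Finset.univ : Finset (Fin 3 → Bool)` listed. [cite: LanglandsShelstad1987, §3] -/
theorem univ_fin_three_bool :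
    (univ : Finset (Fin 3 → Bool)) =
      {![false, false, false], ![false, false, true], ![false, true, false], ![false, true, true],
       ![true, false, false], ![true, false, true], ![true, true, false], ![true, true, true]} := by
  decide

/-- **A sum over `Fin 3 → Bool` is the sum of its eight values** (patterns ordered lexicographically, `false < true`). [cite: LanglandsShelstad1987, §3] -/
theorem sum_univ_fin_three_bool {R : Type*} [AddCommMonoid R] (g : (Fin 3 → Bool) → R) :
    (∑ s : Fin 3 → Bool, g s) =
      g ![false, false, false] + g ![false, false, true] + g ![false, true, false] + g ![false, true, true] +
      g ![true, false, false] + g ![true, false, true] + g ![true, true, false] + g ![true, true, true] := by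
  rw [univ_fin_three_bool, sum_insert (by decide), sum_insert (by decide), sum_insert (by decide), sum_insert (by decide),
    sum_insert (by decide), sum_insert (by decide), sum_insert (by decide), sum_singleton]
  simp only [add_assoc]

/-- A pattern and its complementary pattern as the vectors of their three values. [cite: LanglandsShelstad1987, §3] -/
theorem eq_vec_three_and_compl (s : Fin 3 → Bool) : s = ![s 0, s 1, s 2] ∧ (fun j => !s j) = ![!s 0, !s 1, !s 2] :=
  ⟨by ext j; fin_cases j <;> rfl, by ext j; fin_cases j <;> rfl⟩

/-! ## §2  Vanishing odd sign-character sums ⇒ `N(s) − N(s̄)` is a function of the parity of `s` -/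

/-- **VECTOR FORM.**  If the three odd sign-character sums `Σ_s (−1)^{s_i}·N(s)` (`i = 0, 1, 2`) of `N : (Fin 3 → Bool) → ℤ` vanish, then for any two patterns
`(x, y, z)`, `(x′, y′, z′)` of the same parity `x ⊻ y ⊻ z = x′ ⊻ y′ ⊻ z′` the differences «pattern minus complementary pattern» agree:
`N(x,y,z) − N(¬x,¬y,¬z) = N(x′,y′,z′) − N(¬x′,¬y′,¬z′)`.  (Writing `a, b, c, d` for the differences at the four even patterns `FFF, FTT, TFT, TTF`, the three hypotheses read
`a + b − c − d = 0`, `a − b + c − d = 0`, `a − b − c + d = 0`, whence `a = b = c = d`; the odd patterns carry `−a`.) [cite: LanglandsShelstad1987, §1.3, §3] [cite: Rogawski1990, §4.10 p. 58] -/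
theorem sub_compl_eq_sub_compl_of_odd_sums_eq_zero_vec (N : (Fin 3 → Bool) → ℤ)
    (h : ∀ i : Fin 3, (∑ s : Fin 3 → Bool, (if s i then (-1 : ℤ) else 1) * N s) = 0)
    (x y z x' y' z' : Bool) (hpar : (x ^^ y ^^ z) = (x' ^^ y' ^^ z')) :
    N ![x, y, z] - N ![!x, !y, !z] = N ![x', y', z'] - N ![!x', !y', !z'] := by
  have h0 := h 0
  have h1 := h 1
  have h2 := h 2
  rw [sum_univ_fin_three_bool] at h0 h1 h2
  simp only [Fin.isValue, Matrix.cons_val_zero, Matrix.cons_val_one, Matrix.cons_val, Bool.false_eq_true, ↓reduceIte, one_mul,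
    neg_mul] at h0 h1 h2
  cases x <;> cases y <;> cases z <;> cases x' <;> cases y' <;> cases z' <;>
    simp only [Bool.not_false, Bool.not_true, Bool.xor_false, Bool.xor_true, Bool.false_eq_true, Bool.true_eq_false] at hpar ⊢ <;> omega

/-- **FUNCTION FORM.**  Under the same three vanishing hypotheses, `N(s) − N(s̄) = N(s′) − N(s̄′)` for all patterns `s, s′ : Fin 3 → Bool` of equal parity
(`s̄ = fun j => !s j`). [cite: LanglandsShelstad1987, §1.3, §3] [cite: Rogawski1990, §4.10 p. 58] -/
theorem sub_compl_eq_sub_compl_of_odd_sums_eq_zero (N : (Fin 3 → Bool) → ℤ)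
    (h : ∀ i : Fin 3, (∑ s : Fin 3 → Bool, (if s i then (-1 : ℤ) else 1) * N s) = 0)
    (s s' : Fin 3 → Bool) (hpar : (s 0 ^^ s 1 ^^ s 2) = (s' 0 ^^ s' 1 ^^ s' 2)) :
    N s - N (fun j => !s j) = N s' - N (fun j => !s' j) := by
  rw [(eq_vec_three_and_compl s).2, (eq_vec_three_and_compl s').2]
  conv_lhs => rw [(eq_vec_three_and_compl s).1]
  conv_rhs => rw [(eq_vec_three_and_compl s').1]
  exact sub_compl_eq_sub_compl_of_odd_sums_eq_zero_vec N h _ _ _ _ _ _ hpar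

/-! ## §3  HEAD: the κ-sums along a parity-constant frame map vanish -/

/-- **HEAD — THE EIGHTFOLD ODD-CHARACTER SOCKET.**  Let `N : (Fin 3 → Bool) → ℤ` have vanishing odd sign-character sums (`Σ_s (−1)^{s_i}·N(s) = 0`, `i = 0, 1, 2`) and let
`e : Fin 4 → (Fin 3 → Bool)` be a frame map of CONSTANT PARITY (`e_b 0 ⊻ e_b 1 ⊻ e_b 2` independent of `b` — for the four frames of a type-(1) family the pattern is
`(ε₁ = −1, ε₂ = −1, ω(−1)ε₁ε₂ = −1)`, of parity `[ω(−1) = −1]`).  Then for each κ-character `Σ_b κ_i(b)·(N(e_b) − N(ē_b)) = 0` — the difference is constant in `b` (§2) and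
`Σ_b κ_i(b) = 0` (★ `sum_kappaChar_mul_const`). [cite: LanglandsShelstad1987, §1.3, §3] [cite: Rogawski1990, §4.9 Prop. 4.9.1 (a)(b) p. 55, §4.10 p. 58] [cite: Kottwitz1986BaseChangeUnits, §1 pp. 240–241] -/
theorem sum_kappaChar_mul_sub_compl_eq_zero (N : (Fin 3 → Bool) → ℤ)
    (h : ∀ i : Fin 3, (∑ s : Fin 3 → Bool, (if s i then (-1 : ℤ) else 1) * N s) = 0)
    (e : Fin 4 → Fin 3 → Bool) (hpar : ∀ b : Fin 4, (e b 0 ^^ e b 1 ^^ e b 2) = (e 0 0 ^^ e 0 1 ^^ e 0 2)) (i : Fin 3) :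
    (∑ b : Fin 4, kappaChar i b * (N (e b) - N (fun j => !e b j))) = 0 := by
  have hconst : ∀ b : Fin 4, N (e b) - N (fun j => !e b j) = N (e 0) - N (fun j => !e 0 j) :=
    fun b => sub_compl_eq_sub_compl_of_odd_sums_eq_zero N h (e b) (e 0) (hpar b)
  simp_rw [hconst]
  exact sum_kappaChar_mul_const _ i

/-- **HEAD, BALANCE FORM** (the shape of (β-BAL) in the model): under the same hypotheses `Σ_b κ_i(b)·N(e_b) = Σ_b κ_i(b)·N(ē_b)`.
[cite: LanglandsShelstad1987, §1.3, §3] [cite: Rogawski1990, §4.9 Prop. 4.9.1 (a)(b) p. 55] -/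
theorem sum_kappaChar_mul_eq_sum_kappaChar_mul_compl (N : (Fin 3 → Bool) → ℤ)
    (h : ∀ i : Fin 3, (∑ s : Fin 3 → Bool, (if s i then (-1 : ℤ) else 1) * N s) = 0)
    (e : Fin 4 → Fin 3 → Bool) (hpar : ∀ b : Fin 4, (e b 0 ^^ e b 1 ^^ e b 2) = (e 0 0 ^^ e 0 1 ^^ e 0 2)) (i : Fin 3) :
    (∑ b : Fin 4, kappaChar i b * N (e b)) = ∑ b : Fin 4, kappaChar i b * N (fun j => !e b j) := by
  rw [← sub_eq_zero, ← sum_sub_distrib]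
  simp_rw [← mul_sub]
  exact sum_kappaChar_mul_sub_compl_eq_zero N h e hpar i

end Summit.HodgeConjecture.HodgeConjecture.Cruxes.H413.F0P3cDyRamEightfoldOddCharacterSocket
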